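/- Copyright: the b2b-balaban cell (near-miss cell 7), T⁴-continuum fan-out, lineage t4-ne7b-p1 (node U5c COUNT
member).  Released under the licence of the surrounding project. -/
import Summits.QuantumFields.BalabanUV.T4Continuum.Support.HistoryGenealogyPedigreeChain
import Summits.QuantumFields.BalabanUV.T4Continuum.Support.HistoryGenealogyRealiseW

/-!
# THE PEDIGREE OF A COMPONENT HISTORY, part 4 (junction M4, brick 2c — realisation): every component's `toPGen` is
`RealisesW`-REALISED by print's last-event domain, for any admissible order in prefix-touch form (owner module of row
NE7b, lineage `t4-ne7b-p1` gen 41; re-open object (α), `SCOPE-alpha.md` v2.2 §5 row M4; repair route R-41-a —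
PRE-POSITIONING ONLY)

Summits-side support leaf of the T⁴-continuum cell (rung (B)+1 on a FINITE torus only; NOT infinite volume, NOT the
mass gap, NOT the Clay statement; NOT a proof of the spine estimate NE7b, which is the cell's OWN estimate, NOT PRINTED
and NOT PROVED).  [folklore] finite combinatorics in the ℤᵈ index model over parts 1–3 (`pedOf`, `OrderOK`, the
`toPGen` unfoldings), brick 1 (`TouchPrefix`), the memory-agnostic core `HistoryRealiseWeak` (`RealisesW`), leaf-05's
`HistoryGenealogyRealiseW` (`GeomHistoryR.LevelClausesW`) and rows S13-R∕S14-R (`pgenR`, `edomR`); nothing printed is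
asserted, no `def … : Prop` fact of Bałaban's, zero `sorry`.  B16 = [Balaban1989LargeFieldII] pp. 384–387 under audit;
locators only.

WHY.  The END's field `real` asks, for every live component, `RealisesW L s R ((ped).toPGen cellP c) Z ∧ PendingBefore …`.
Rows S14-R∕S14-W realise print's RIGHT-nested leaf-first extraction `pgenR`; the END reads the LEFT-nested oldest-first
`toPGen` of the pedigree (D-M4-2).  THIS FILE proves the realisation for `toPGen` directly, for ANY order `ord` that is
a permutation of the constituents (`OrderOK`) and lists, for components of several constituents, each image touching
the running union of the earlier ones (`TouchOK` — the prefix-touch form of (G-touch); CONSTRUCTED from the touch clause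
with an oldest head in part 5): level by level through print's trichotomy, lone unflagged part ↦ inherited (1.83), lone
flagged part ↦ the W renewal clause fed by (G-readyW) («components of Z_j satisfying (i), (ii), for which some large
fields are created», p. 383), lone new region ↦ birth, several constituents ↦ the left-nested chain realised by the
running unions (`realisesW_chainJoin`), flagged parts entering renewed and pending at their own step, unflagged ones by
(G-pendR), births trivially.  No «no fresh clusters» condition is needed HERE (a fresh cluster is realisable as a chain
of same-level births; only `HeadOldest` excludes it — part 3).

WHAT IS PROVED (part 4a `…PedigreeChain` carries `realisesW_chainJoin`, the list plumbing `realisesW_chainJoin_cons₂` and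
`lastStep_toPGen_eq_pgenR`).  Here: the displayed order property **`TouchOK`**, the
constituent pairs `ppair`, and the main theorem **`realisesW_toPGen`**: `∀ c ∈ comp j, RealisesW L s R ((pedOf H rnw
ord).toPGen id (j, c)) (edomR H rnw dom j c) ∧ dom j c = orbit L s (…).lastStep (edomR … j c) (j − lastStep)`; corollaries
`realisesW_of_mem_comp_ped`, `dom_eq_orbit_ped`, `disjoint_orbit_of_disjoint_dom_ped`.

HONEST.  Proves nothing of Bałaban's; the order is a parameter here (constructed in part 5); `track`∕`inBox` (brick 3)
open; NE7b NOT proved; spine 0∕9.  HONEST DEPENDENCY (cell): continuum YM on T⁴ ⇐ BetaPertH ∧ nine spine estimates (0/9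
proved); BetaPertH ⇐ (D1) ∧ (D4) ∧ CAP+tail; G-an2-4 gates asym, D1 and NE2/3/4.  This file changes none of it. -/

open Finset
open Literature.MathematicalPhysics.QuantumFieldTheory.Balaban1983to89
open Literature.MathematicalPhysics.QuantumFieldTheory.Balaban1983to89.B13ScaleTransfer
open Literature.MathematicalPhysics.QuantumFieldTheory.Balaban1983to89.B16SProfile
open Literature.MathematicalPhysics.QuantumFieldTheory.Balaban1983to89.B16MergeGeometry
open T4PersistenceDictionary
open Summit.QuantumFields.BalabanUV.T4Continuum.HistoryAdmissible
open Summit.QuantumFields.BalabanUV.T4Continuum.HistoryRealise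
open Summit.QuantumFields.BalabanUV.T4Continuum.HistoryRealisePrint
open Summit.QuantumFields.BalabanUV.T4Continuum.HistoryRealiseWeak
open Summit.QuantumFields.BalabanUV.T4Continuum.HistoryGen
open Summit.QuantumFields.BalabanUV.T4Continuum.HistoryGenealogyExtraction
open Summit.QuantumFields.BalabanUV.T4Continuum.HistoryGenealogyRealise
open Summit.QuantumFields.BalabanUV.T4Continuum.HistoryGenealogyRealise.GeomHistoryR

namespace Summit.QuantumFields.BalabanUV.T4Continuum.HistoryGenealogyPedigree

noncomputable section

variable {d : ℕ}

/-! ## §3 The realisation theorem for the pedigree -/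

section Defs

variable (H : ComponentHistory (Lab d)) (rnw : ℕ → Lab d → Bool) (ord : ℕ → Lab d → List (Lab d ⊕ Lab d))
  (dom : ℕ → Lab d → Finset (Pt d)) (L : ℕ) (s : ℕ → ℕ)

/-- **THE DISPLAYED ORDER PROPERTY `TouchOK`**: for a component listed with at least two constituents, each later
constituent's image touches the running union of the head's image and the images before it (the prefix-touch form of
(G-touch), from the chosen head). [folklore] -/
def TouchOK : Prop :=
  ∀ j c, c ∈ H.comp j → ∀ q₀ q₁ qs, ord j c = q₀ :: q₁ :: qs →
    TouchPrefix (imgC L s dom j q₀) ((q₁ :: qs).map (imgC L s dom j))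

/-- the (history, last-event domain) pairs of the constituents of a level-`(j+1)` component IN THE PEDIGREE CURRENCY: a
flagged part enters renewed at `j` with its S-image, an unflagged part with its own `toPGen` and last-event domain, a
new region as a birth [folklore] -/
def ppair (j : ℕ) : Lab d ⊕ Lab d → PGen (Lab d) × Finset (Pt d) :=
  Sum.elim
    (fun p => if rnw j p = true then (PGen.renew ((pedOf H rnw ord).toPGen id (j, p)) j, Sop (ratio L s j) (dom j p))
      else ((pedOf H rnw ord).toPGen id (j, p), edomR H rnw dom j p))
    fun n => (PGen.birth (j + 1) (H.cls n) n, n.2)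

/-- the pairs at level `0`: births with their regions (the left branch is vacuous under `WF`) [folklore] -/
def ppair0 : Lab d ⊕ Lab d → PGen (Lab d) × Finset (Pt d) :=
  Sum.elim (fun p => ((pedOf H rnw ord).toPGen id (0, p), edomR H rnw dom 0 p)) fun n => (PGen.birth 0 (H.cls n) n, n.2)

end Defs

section Main

variable {L : ℕ} {s R : ℕ → ℕ} {H : ComponentHistory (Lab d)} {rnw : ℕ → Lab d → Bool}
  {ord : ℕ → Lab d → List (Lab d ⊕ Lab d)} {dom : ℕ → Lab d → Finset (Pt d)}

/-- the first components of `ppair` are the parts' `PGen`s of the unfolding `toPGen_succ` [folklore] -/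
theorem fst_ppair (j : ℕ) (q : Lab d ⊕ Lab d) :
    (ppair H rnw ord dom L s j q).1 =
      Sum.elim (fun p => if rnw j p = true then PGen.renew ((pedOf H rnw ord).toPGen id (j, p)) j
          else (pedOf H rnw ord).toPGen id (j, p)) (fun n => PGen.birth (j + 1) (H.cls n) (id n)) q := by
  cases q with
  | inl p => by_cases h : rnw j p = true <;> simp [ppair, h]
  | inr n => rfl

/-- **THE REALISATION THEOREM FOR THE PEDIGREE (W currency).**  Under `WF`, an admissible order in prefix-touch form
and the displayed clauses `LevelClausesW`, every component's `toPGen id` is `RealisesW`-realised by print's last-event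
domain `edomR`, and the current domain is the orbit of the last-event domain from the last step. [folklore] -/
theorem realisesW_toPGen (hW : H.WF) (hO : OrderOK H ord) (hT : TouchOK H ord dom L s)
    (hG : LevelClausesW H rnw dom L s R) :
    ∀ (j : ℕ) (c : Lab d), c ∈ H.comp j →
      RealisesW L s R ((pedOf H rnw ord).toPGen id (j, c)) (edomR H rnw dom j c) ∧
        dom j c = orbit L s ((pedOf H rnw ord).toPGen id (j, c)).lastStep (edomR H rnw dom j c)
          (j - ((pedOf H rnw ord).toPGen id (j, c)).lastStep) := by
  intro j
  induction j with
  | zero =>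
      intro c hc
      have hl0 : lefts (ord 0 c) = [] := lefts_ord_zero hW hO hc
      have hmem : ∀ x ∈ ord 0 c, ∃ n, x = Sum.inr n ∧ n ∈ H.newReg 0 := by
        intro x hx
        obtain ⟨n, rfl⟩ := exists_inr_of_lefts_eq_nil hl0 x hx
        exact ⟨n, rfl, hW.news_sub 0 c hc n (mem_news_of_inr_mem_ord hO hc hx)⟩
      have hrights : (rights (ord 0 c)).map (fun n => PGen.birth 0 (H.cls n) (id n)) =
          (ord 0 c).map (fun x => (ppair0 H rnw ord dom x).1) := by
        have : (fun x => (ppair0 H rnw ord dom x).1) =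
            Sum.elim (fun p => (pedOf H rnw ord).toPGen id (0, p)) fun n => PGen.birth 0 (H.cls n) (id n) :=
          funext fun x => by cases x <;> rfl
        rw [this, map_sum_elim_of_lefts_eq_nil _ _ _ hl0]
      have himg : ∀ x ∈ ord 0 c, img L s 0 (ppair0 H rnw ord dom x) = imgC L s dom 0 x := by
        intro x hx; obtain ⟨n, rfl, -⟩ := hmem x hx; simp [ppair0, img, PGen.lastStep]
      have hall : ∀ x ∈ ord 0 c, RealisesW L s R (ppair0 H rnw ord dom x).1 (ppair0 H rnw ord dom x).2 ∧
          (ppair0 H rnw ord dom x).1.lastStep ≤ 0 ∧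
          PendingBefore L s R (ppair0 H rnw ord dom x).1.lastStep (ppair0 H rnw ord dom x).2 0 := by
        intro x hx
        obtain ⟨n, rfl, hn⟩ := hmem x hx
        exact ⟨realisesW_of_realisesP _ _ (realisesP_birth_of_new_ok (hG.new_ok 0 n hn) 0), le_rfl,
          pendingBefore_self L s R 0 _⟩
      rw [toPGen_zero H rnw ord id hc, hrights, edomR_zero]
      obtain ⟨q₀, qs, hqs⟩ := List.exists_cons_of_ne_nil (ord_ne_nil hW hO hc)
      obtain ⟨n₀, rfl, hn₀⟩ := hmem q₀ (by rw [hqs]; exact List.mem_cons_self)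
      cases qs with
      | nil =>
          have hcs := constit_eq_singleton_of_ord hO hc hqs
          rw [hqs]
          simp only [List.map_cons, List.map_nil, ppair0, Sum.elim_inr, Pedigree.joinP, chainJoin]
          rw [hG.dom_birth 0 c n₀ hc hcs]
          exact ⟨realisesW_of_realisesP _ _ (realisesP_birth_of_new_ok (hG.new_ok 0 n₀ hn₀) 0), by simp [PGen.lastStep]⟩
      | cons q₁ qs' =>
          -- a fresh cluster at level 0: the chain of births at step 0 (realisable; only `HeadOldest` excludes it)
          have h2 := two_le_length_constit_of_ord hO hc hqs
          have hZ : dom 0 c ⊆ unionL ((Sum.inr n₀ :: q₁ :: qs').map (imgC L s dom 0)) := by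
            rw [← hqs]
            refine (hG.dom_join 0 c hc h2).trans (unionL_subset_of_forall_mem fun A hA => ?_)
            obtain ⟨q, hq, rfl⟩ := List.mem_map.1 hA
            exact List.mem_map.2 ⟨q, (hO 0 c hc).mem_iff.2 hq, rfl⟩
          obtain ⟨hR, hlast⟩ := realisesW_chainJoin_cons₂ (L := L) (s := s) (R := R) 0 (ppair0 H rnw ord dom)
            (imgC L s dom 0) (Sum.inr n₀) q₁ qs' (fun x hx => hall x (by rw [hqs]; exact hx))
            (fun x hx => himg x (by rw [hqs]; exact hx)) (hT 0 c hc _ q₁ qs' hqs) hZ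
          rw [hqs, List.map_cons]
          simp only [Pedigree.joinP, step_pedOf]
          exact ⟨hR, by rw [hlast]; simp⟩
  | succ j ih =>
      intro c hc
      -- induction hypothesis on the parts, and the image of an old part at level `j + 1`
      have ihp : ∀ p ∈ H.parts (j + 1) c,
          RealisesW L s R ((pedOf H rnw ord).toPGen id (j, p)) (edomR H rnw dom j p) ∧
            dom j p = orbit L s ((pedOf H rnw ord).toPGen id (j, p)).lastStep (edomR H rnw dom j p)
              (j - ((pedOf H rnw ord).toPGen id (j, p)).lastStep) :=
        fun p hp => ih p (hW.parts_sub j c hc p hp)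
      have hlastp : ∀ p ∈ H.parts (j + 1) c,
          ((pedOf H rnw ord).toPGen id (j, p)).lastStep = (H.pgenR rnw j p).lastStep :=
        fun p hp => lastStep_toPGen_eq_pgenR id hW hO j p (hW.parts_sub j c hc p hp)
      have hlep : ∀ p ∈ H.parts (j + 1) c, ((pedOf H rnw ord).toPGen id (j, p)).lastStep ≤ j :=
        fun p hp => lastStep_toPGen_le id hW hO (hW.parts_sub j c hc p hp)
      have himgp : ∀ p ∈ H.parts (j + 1) c,
          orbit L s ((pedOf H rnw ord).toPGen id (j, p)).lastStep (edomR H rnw dom j p)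
              (j + 1 - ((pedOf H rnw ord).toPGen id (j, p)).lastStep) = Sop (ratio L s j) (dom j p) := by
        intro p hp
        rw [(ihp p hp).2, orbit_level_succ L s (hlep p hp)]
      -- the renewal of a flagged part is realised by its S-image (the W clause fed by (G-readyW))
      have hren : ∀ p ∈ H.parts (j + 1) c, rnw j p = true →
          RealisesW L s R (PGen.renew ((pedOf H rnw ord).toPGen id (j, p)) j) (Sop (ratio L s j) (dom j p)) := by
        intro p hp hf
        obtain ⟨hlt, hI, hfirst⟩ := hG.ready j c hc p hp hf
        rw [← hlastp p hp] at hlt hI hfirst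
        exact ⟨edomR H rnw dom j p, (ihp p hp).1, hlt, hI, hfirst, (himgp p hp).symm⟩
      obtain ⟨q₀, qs, hqs⟩ := List.exists_cons_of_ne_nil (ord_ne_nil hW hO hc)
      cases qs with
      | nil =>
          have hcs := constit_eq_singleton_of_ord hO hc hqs
          cases q₀ with
          | inl p =>
              have hp : p ∈ H.parts (j + 1) c := by simp [ComponentHistory.parts, hcs]
              have hflow := hG.dom_flow j c p hc hcs
              cases hf : rnw j p with
              | false =>
                  -- LONE UNFLAGGED PART: no event, inherited
                  rw [toPGen_succ_lone H rnw ord id hc hqs hf, edomR_succ_lone H rnw dom hcs hf]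
                  refine ⟨(ihp p hp).1, ?_⟩
                  rw [hflow, ← himgp p hp]
              | true =>
                  -- LONE FLAGGED PART: renewal
                  have hev : edomR H rnw dom (j + 1) c = dom (j + 1) c :=
                    edomR_succ_event H rnw dom (by simp [lonePartR, hcs, hf])
                  rw [toPGen_succ_renew H rnw ord id hc hqs hf, hev, hflow]
                  exact ⟨hren p hp hf, by simp [PGen.lastStep]⟩
          | inr n =>
              -- LONE BIRTH
              have hn : n ∈ H.newReg (j + 1) := hW.news_sub (j + 1) c hc n (by simp [ComponentHistory.news, hcs])
              have hev : edomR H rnw dom (j + 1) c = dom (j + 1) c :=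
                edomR_succ_event H rnw dom (by simp [lonePartR, hcs])
              rw [toPGen_succ_birth H rnw ord id hc hqs, hev, hG.dom_birth (j + 1) c n hc hcs]
              exact ⟨realisesW_of_realisesP _ _ (realisesP_birth_of_new_ok (hG.new_ok (j + 1) n hn) (j + 1)),
                by simp [PGen.lastStep]⟩
      | cons q₁ qs' =>
          -- JOIN CHAIN at step j + 1 in the chosen prefix-touch order
          have h2 := two_le_length_constit_of_ord hO hc hqs
          have hev : edomR H rnw dom (j + 1) c = dom (j + 1) c := by
            refine edomR_succ_event H rnw dom ?_
            obtain ⟨x, l, hxl⟩ := List.exists_cons_of_ne_nil (hW.nonempty (j + 1) c hc)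
            cases l with
            | nil => rw [hxl] at h2; simp at h2
            | cons y l' => rw [hxl]; cases x <;> rfl
          have hmemq : ∀ x ∈ ord (j + 1) c, x ∈ H.constit (j + 1) c := fun x hx => (hO (j + 1) c hc).mem_iff.1 hx
          have himg : ∀ x ∈ ord (j + 1) c, img L s (j + 1) (ppair H rnw ord dom L s j x) = imgC L s dom (j + 1) x := by
            intro x hx
            cases x with
            | inl p =>
                have hp : p ∈ H.parts (j + 1) c := (mem_lefts_iff p _).2 (hmemq _ hx)
                by_cases hf : rnw j p = true
                · simp [ppair, hf, img, PGen.lastStep]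
                · simpa [ppair, hf, img] using himgp p hp
            | inr n => simp [ppair, img, PGen.lastStep]
          have hall : ∀ x ∈ ord (j + 1) c,
              RealisesW L s R (ppair H rnw ord dom L s j x).1 (ppair H rnw ord dom L s j x).2 ∧
                (ppair H rnw ord dom L s j x).1.lastStep ≤ j + 1 ∧
                PendingBefore L s R (ppair H rnw ord dom L s j x).1.lastStep (ppair H rnw ord dom L s j x).2 (j + 1) := by
            intro x hx
            cases x with
            | inl p =>
                have hp : p ∈ H.parts (j + 1) c := (mem_lefts_iff p _).2 (hmemq _ hx)
                by_cases hf : rnw j p = true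
                · -- renewed at `j`, merged at `j + 1`: pending at its own step
                  have hpp : ppair H rnw ord dom L s j (Sum.inl p) =
                      (PGen.renew ((pedOf H rnw ord).toPGen id (j, p)) j, Sop (ratio L s j) (dom j p)) := by
                    simp [ppair, hf]
                  rw [hpp]
                  exact ⟨hren p hp hf, le_rfl, pendingBefore_self L s R (j + 1) _⟩
                · have hf' : rnw j p = false := by simpa using hf
                  have hpp : ppair H rnw ord dom L s j (Sum.inl p) =
                      ((pedOf H rnw ord).toPGen id (j, p), edomR H rnw dom j p) := by
                    simp [ppair, hf']
                  rw [hpp]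
                  refine ⟨(ihp p hp).1, (hlep p hp).trans (Nat.le_succ j), ?_⟩
                  show PendingBefore L s R ((pedOf H rnw ord).toPGen id (j, p)).lastStep (edomR H rnw dom j p) (j + 1)
                  rw [hlastp p hp]
                  exact hG.pend j c hc h2 p hp hf'
            | inr n =>
                have hn : n ∈ H.newReg (j + 1) := hW.news_sub (j + 1) c hc n ((mem_rights_iff n _).2 (hmemq _ hx))
                exact ⟨realisesW_of_realisesP _ _ (realisesP_birth_of_new_ok (hG.new_ok (j + 1) n hn) (j + 1)), le_rfl,
                  pendingBefore_self L s R (j + 1) _⟩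
          have hZ : dom (j + 1) c ⊆ unionL ((q₀ :: q₁ :: qs').map (imgC L s dom (j + 1))) := by
            rw [← hqs]
            refine (hG.dom_join (j + 1) c hc h2).trans (unionL_subset_of_forall_mem fun A hA => ?_)
            obtain ⟨q, hq, rfl⟩ := List.mem_map.1 hA
            exact List.mem_map.2 ⟨q, (hO (j + 1) c hc).mem_iff.2 hq, rfl⟩
          obtain ⟨hR, hlast⟩ := realisesW_chainJoin_cons₂ (L := L) (s := s) (R := R) (j + 1)
            (ppair H rnw ord dom L s j) (imgC L s dom (j + 1)) q₀ q₁ qs' (fun x hx => hall x (by rw [hqs]; exact hx))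
            (fun x hx => himg x (by rw [hqs]; exact hx)) (hT (j + 1) c hc q₀ q₁ qs' hqs) hZ
          have hchain : (pedOf H rnw ord).toPGen id (j + 1, c) =
              chainJoin (ppair H rnw ord dom L s j q₀).1 ((q₁ :: qs').map fun x => (ppair H rnw ord dom L s j x).1)
                (j + 1) := by
            rw [toPGen_succ_chain H rnw ord id hc hqs, fst_ppair]
            congr 1
            exact List.map_congr_left fun x _ => (fst_ppair j x).symm
          rw [hchain, hev, hlast]
          exact ⟨hR, by simp⟩

/-- **EVERY COMPONENT'S `toPGen` IS REALISED (W currency) by print's last-event domain.** [folklore] -/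
theorem realisesW_of_mem_comp_ped (hW : H.WF) (hO : OrderOK H ord) (hT : TouchOK H ord dom L s)
    (hG : LevelClausesW H rnw dom L s R) {j : ℕ} {c : Lab d} (hc : c ∈ H.comp j) :
    RealisesW L s R ((pedOf H rnw ord).toPGen id (j, c)) (edomR H rnw dom j c) :=
  (realisesW_toPGen hW hO hT hG j c hc).1

/-- **THE CURRENT DOMAIN IS THE ORBIT OF THE LAST-EVENT DOMAIN** (pedigree form). [folklore] -/
theorem dom_eq_orbit_ped (hW : H.WF) (hO : OrderOK H ord) (hT : TouchOK H ord dom L s)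
    (hG : LevelClausesW H rnw dom L s R) {j : ℕ} {c : Lab d} (hc : c ∈ H.comp j) :
    dom j c = orbit L s ((pedOf H rnw ord).toPGen id (j, c)).lastStep (edomR H rnw dom j c)
      (j - ((pedOf H rnw ord).toPGen id (j, c)).lastStep) :=
  (realisesW_toPGen hW hO hT hG j c hc).2

/-- disjoint current domains of distinct components transfer to the orbits (pedigree form; the END's `curDomain`)
[folklore] -/
theorem disjoint_orbit_of_disjoint_dom_ped (hW : H.WF) (hO : OrderOK H ord) (hT : TouchOK H ord dom L s)
    (hG : LevelClausesW H rnw dom L s R) {K : ℕ} {c c' : Lab d} (hc : c ∈ H.comp K) (hc' : c' ∈ H.comp K)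
    (hdis : Disjoint (dom K c) (dom K c')) :
    Disjoint
      (orbit L s ((pedOf H rnw ord).toPGen id (K, c)).lastStep (edomR H rnw dom K c)
        (K - ((pedOf H rnw ord).toPGen id (K, c)).lastStep))
      (orbit L s ((pedOf H rnw ord).toPGen id (K, c')).lastStep (edomR H rnw dom K c')
        (K - ((pedOf H rnw ord).toPGen id (K, c')).lastStep)) := by
  rwa [← dom_eq_orbit_ped hW hO hT hG hc, ← dom_eq_orbit_ped hW hO hT hG hc']

end Main

end

end Summit.QuantumFields.BalabanUV.T4Continuum.HistoryGenealogyPedigree
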